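import Mathlib.Algebra.BigOperators.Fin
import Mathlib.Combinatorics.Additive.AP.Three.Defs
import Literature.Computability.AlgebraicComplexity.RelativeExponentProofs
import HarnessLib

/-!
# Monomial restrictions between powers of `⟨2,2,2⟩`, `⟨2⟩` and large diagonals: the Ruzsa–Szemerédi construction

Topic `Literature/Computability/AlgebraicComplexity`. PROVED ingredients for the monomial
irreversibility barrier of Christandl–Vrana–Zuiddam (Theory of Computing 17 (2021), art. 2 =
arXiv:1812.06952, §2.4 and Thm. 13; `IrreversibilityBarrier.lean`), namely for the identity
`ω_M(⟨2,2,2⟩, ⟨2⟩) = 1/2` stated there after Prop. 7 ("the standard construction for (subexp) in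
fact shows that `ω_M(⟨2,2,2⟩,⟨2⟩) = 1/2`"), in the coordinate format of `AsymptoticSpectrum.lean`
(`matMulTensor`, `unitTensor`, `kroneckerPow`) and for MONOMIAL RESTRICTION `≥_M`
(`TensorMonRestrictsTo`, generalised sub-permutation matrices, `RelativeExponent.lean`).

## Content

* `tensorMonRestrictsTo_kroneckerPow_mul'` — `(t^{⊗n})^{⊗N} ≥_M t^{⊗(N n)}` (the converse
  relabelling of `tensorMonRestrictsTo_kroneckerPow_mul`, `RelativeExponentProofs.lean`), and
  `tensorMonRestrictsTo_monRestrictionCost` — under one witness `t^{⊗m} ≥_M s` the minimum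
  `monRestrictionCost t s n` is attained.
* `tensorMonRestrictsTo_kroneckerPow_matMulTensor` — `⟨k,m,n⟩^{⊗L} ≥_M ⟨k^L, m^L, n^L⟩`
  (relabelling along `finFunctionFinEquiv`).
* `tensorMonRestrictsTo_unitTensor_kroneckerPow_unitTensor` — `⟨Q⟩ ≥_M ⟨q⟩^{⊗r}` for `q^r ≤ Q`.
* `tensorMonRestrictsTo_unitTensor_of_diagonal` — an INDUCED MATCHING of size `|D|` in the support
  (injective `φ₁, φ₂, φ₃ : D → …` with `t (φ₁ d₁) (φ₂ d₂) (φ₃ d₃) = [d₁ = d₂ = d₃]`) gives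
  `t ≥_M ⟨|D|⟩`; for `≥_M` into a diagonal this is also necessary, so the monomial subrank of `t`
  is a property of the support hypergraph (CVZ §2.4: "`Q_M` and `Q̃_M` only depend on the support").
* `tensorMonRestrictsTo_matMulTensor_unitTensor_of_threeAPFree` — **the Ruzsa–Szemerédi
  construction**: for a set `A ⊆ {0,…,n-1}` without 3-term arithmetic progressions and `3n ≤ P`,
  the triangles `(x, x+a, x+2a)`, `x < n`, `a ∈ A`, are an induced matching in
  `supp ⟨P,P,P⟩ = {((i,l),(i,j),(j,l))}`, whence `⟨P,P,P⟩ ≥_M ⟨n·|A|⟩`.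

## Remarks on the source

CVZ's own pointer for `ω_M(⟨2,2,2⟩,⟨2⟩) = 1/2` is "the standard construction" behind
`Q̃(⟨h,h,h⟩) = h²` (their (wecan), citing Strassen, J. reine angew. Math. 384 (1988)), i.e.
Strassen's degeneration `⟨n,n,n⟩ ⊵ ⟨⌈3n²/4⌉⟩` (J. reine angew. Math. 375/376 (1987)), which is a
monomial DEGENERATION; CVZ explicitly allow `≥_M` to be read as monomial degeneration (§2.4,
parenthetical remark). For monomial RESTRICTION — the reading formalised in `RelativeExponent.lean`
— a monomial restriction `⟨P,P,P⟩ ≥_M ⟨R⟩` is exactly an induced matching of size `R` in the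
triangle hypergraph, i.e. a Ruzsa–Szemerédi configuration, so that `Q_M(⟨P,P,P⟩) = o(P²)`
(triangle removal) while `Q_M(⟨P,P,P⟩) ≥ P² e^{-O(√log P)}` by the construction above fed with
Behrend's 3-AP-free sets; the asymptotic consequence needed for CVZ Thm. 13 — for every `ε > 0`
and all large `L`, `⟨2,2,2⟩^{⊗L} ≥_M ⟨2⟩^{⊗r}` with `r ≥ (2−ε)L`, i.e. `ω_M(⟨2,2,2⟩,⟨2⟩) ≤ 1/2` —
is derived from Mathlib's `Behrend.roth_lower_bound` in `MatMulMonomialSubrankAsymptotics.lean`.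
The construction is the classical one of Ruzsa–Szemerédi (1978); we tag it folklore.
-/

noncomputable section

open scoped BigOperators

namespace Literature.Computability.AlgebraicComplexity

universe u

variable {K : Type u} [CommSemiring K]

/-! ## Two complements to the monomial-restriction calculus -/

section Calculus

variable {ι κ μ ι' κ' μ' : Type*} [Fintype ι] [Fintype κ] [Fintype μ]

/-- Un-flattening a family `Fin (N n) → α` to `Fin N → Fin n → α` along `finProdFinEquiv` is
injective. [folklore] -/
theorem unflattenFin_injective {α : Type*} (N n : ℕ) :
    Function.Injective (fun (a : Fin (N * n) → α) (i : Fin N) (j : Fin n) =>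
      a (finProdFinEquiv (i, j))) := by
  intro a₁ a₂ h
  funext x
  obtain ⟨⟨i, j⟩, rfl⟩ := finProdFinEquiv.surjective x
  exact congrFun (congrFun h i) j

/-- **Power of a power, converse direction**: `(t^{⊗n})^{⊗N} ≥_M t^{⊗(N n)}` (relabelling along
`finProdFinEquiv`; with `tensorMonRestrictsTo_kroneckerPow_mul` the two powers are monomially
inter-restrictable). [folklore] -/
theorem tensorMonRestrictsTo_kroneckerPow_mul' (t : ι → κ → μ → K) (N n : ℕ) :
    TensorMonRestrictsTo (kroneckerPow (kroneckerPow t n) N) (kroneckerPow t (N * n)) := by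
  have key : kroneckerPow t (N * n) = fun a b c =>
      kroneckerPow (kroneckerPow t n) N (fun i j => a (finProdFinEquiv (i, j)))
        (fun i j => b (finProdFinEquiv (i, j))) (fun i j => c (finProdFinEquiv (i, j))) := by
    funext a b c
    simp only [kroneckerPow_apply]
    rw [← Fintype.prod_prod_type' (f := fun i j =>
      t (a (finProdFinEquiv (i, j))) (b (finProdFinEquiv (i, j))) (c (finProdFinEquiv (i, j))))]
    exact Fintype.prod_equiv finProdFinEquiv.symm _ _ fun x => by
      simp only [Prod.mk.eta, Equiv.apply_symm_apply]
  rw [key]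
  exact tensorMonRestrictsTo_precomp _ (unflattenFin_injective N n) (unflattenFin_injective N n)
    (unflattenFin_injective N n)

/-- Under a witness `t^{⊗m} ≥_M s`, every set `{m' | t^{⊗m'} ≥_M s^{⊗n}}` is nonempty and the
minimum `monRestrictionCost t s n` is attained: `t^{⊗ monRestrictionCost t s n} ≥_M s^{⊗n}`.
[cite: ChristandlVranaZuiddam2021, §2.4] -/
theorem tensorMonRestrictsTo_monRestrictionCost {t : ι → κ → μ → K} {s : ι' → κ' → μ' → K}
    {m : ℕ} (h : TensorMonRestrictsTo (kroneckerPow t m) s) (n : ℕ) :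
    TensorMonRestrictsTo (kroneckerPow t (monRestrictionCost t s n)) (kroneckerPow s n) :=
  Nat.sInf_mem (s := {m' : ℕ | TensorMonRestrictsTo (kroneckerPow t m') (kroneckerPow s n)})
    ⟨n * m, tensorMonRestrictsTo_kroneckerPow_mul_of h n⟩

end Calculus

/-! ## Powers of `⟨k,m,n⟩` and of `⟨q⟩` -/

section Powers

/-- Un-flattening a pair of `Fin`-codes into an `L`-tuple of pairs is injective. [folklore] -/
theorem pairTuple_injective (k n L : ℕ) :
    Function.Injective (fun (p : Fin (k ^ L) × Fin (n ^ L)) (i : Fin L) =>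
      ((finFunctionFinEquiv.symm p.1) i, (finFunctionFinEquiv.symm p.2) i)) := by
  intro p q h
  have h1 : ∀ i, (finFunctionFinEquiv.symm p.1) i = (finFunctionFinEquiv.symm q.1) i ∧
      (finFunctionFinEquiv.symm p.2) i = (finFunctionFinEquiv.symm q.2) i := fun i => by
    have := congrFun h i
    simpa [Prod.ext_iff] using this
  refine Prod.ext ?_ ?_
  · exact finFunctionFinEquiv.symm.injective (funext fun i => (h1 i).1)
  · exact finFunctionFinEquiv.symm.injective (funext fun i => (h1 i).2)

variable (K) in
/-- **Entries of `⟨k,m,n⟩^{⊗L}` along the un-flattening maps are those of `⟨k^L, m^L, n^L⟩`**: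
`⟨k,m,n⟩^{⊗L} ≅ ⟨k^L,m^L,n^L⟩` (CVZ §2.1: "`⟨n,n,n⟩^{⊗N} = ⟨n^N,n^N,n^N⟩`" up to relabelling).
[folklore] -/
theorem matMulTensor_pow_eq_kroneckerPow_comp (k m n L : ℕ) :
    matMulTensor K (k ^ L) (m ^ L) (n ^ L) = fun a b c =>
      kroneckerPow (matMulTensor K k m n) L
        (fun i => ((finFunctionFinEquiv.symm a.1) i, (finFunctionFinEquiv.symm a.2) i))
        (fun i => ((finFunctionFinEquiv.symm b.1) i, (finFunctionFinEquiv.symm b.2) i))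
        (fun i => ((finFunctionFinEquiv.symm c.1) i, (finFunctionFinEquiv.symm c.2) i)) := by
  funext a b c
  simp only [kroneckerPow_apply, matMulTensor]
  by_cases h : a.1 = b.1 ∧ b.2 = c.1 ∧ a.2 = c.2
  · rw [if_pos h]
    obtain ⟨h1, h2, h3⟩ := h
    symm
    refine Finset.prod_eq_one fun i _ => ?_
    rw [if_pos ⟨by rw [h1], by rw [h2], by rw [h3]⟩]
  · rw [if_neg h]
    symm
    have : ∃ i, ¬ ((finFunctionFinEquiv.symm a.1) i = (finFunctionFinEquiv.symm b.1) i ∧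
        (finFunctionFinEquiv.symm b.2) i = (finFunctionFinEquiv.symm c.1) i ∧
        (finFunctionFinEquiv.symm a.2) i = (finFunctionFinEquiv.symm c.2) i) := by
      by_contra hall
      push Not at hall
      refine h ⟨?_, ?_, ?_⟩
      · exact finFunctionFinEquiv.symm.injective (funext fun i => (hall i).1)
      · exact finFunctionFinEquiv.symm.injective (funext fun i => (hall i).2.1)
      · exact finFunctionFinEquiv.symm.injective (funext fun i => (hall i).2.2)
    obtain ⟨i, hi⟩ := this
    exact Finset.prod_eq_zero (Finset.mem_univ i) (if_neg hi)

variable (K) in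
/-- **`⟨k,m,n⟩^{⊗L} ≥_M ⟨k^L, m^L, n^L⟩`** (relabelling along the un-flattening bijections is a
monomial restriction). [folklore] -/
theorem tensorMonRestrictsTo_kroneckerPow_matMulTensor (k m n L : ℕ) :
    TensorMonRestrictsTo (kroneckerPow (matMulTensor K k m n) L)
      (matMulTensor K (k ^ L) (m ^ L) (n ^ L)) := by
  rw [matMulTensor_pow_eq_kroneckerPow_comp K k m n L]
  exact tensorMonRestrictsTo_precomp _ (pairTuple_injective k n L) (pairTuple_injective k m L)
    (pairTuple_injective m n L)

variable (K) in
/-- **Entries of `⟨q⟩^{⊗r}`**: `⟨q⟩^{⊗r} (a,b,c) = [a = b = c] = ⟨Q⟩ (f a, f b, f c)` for any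
injective `f` (here `Fin.castLE ∘ finFunctionFinEquiv`, `q^r ≤ Q`). [folklore] -/
theorem kroneckerPow_unitTensor_eq_comp {q r Q : ℕ} (h : q ^ r ≤ Q) :
    kroneckerPow (unitTensor K q) r = fun a b c =>
      unitTensor K Q (Fin.castLE h (finFunctionFinEquiv a)) (Fin.castLE h (finFunctionFinEquiv b))
        (Fin.castLE h (finFunctionFinEquiv c)) := by
  have hinj : Function.Injective (fun a : Fin r → Fin q => Fin.castLE h (finFunctionFinEquiv a)) :=
    (Fin.castLE_injective h).comp finFunctionFinEquiv.injective
  funext a b c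
  simp only [kroneckerPow_apply, unitTensor_apply]
  by_cases hd : a = b ∧ b = c
  · obtain ⟨rfl, rfl⟩ := hd
    simp
  · rw [if_neg (fun h' => hd ⟨hinj h'.1, hinj h'.2⟩)]
    have : ∃ i, ¬ (a i = b i ∧ b i = c i) := by
      by_contra hall
      push Not at hall
      exact hd ⟨funext fun i => (hall i).1, funext fun i => (hall i).2⟩
    obtain ⟨i, hi⟩ := this
    exact Finset.prod_eq_zero (Finset.mem_univ i) (if_neg hi)

variable (K) in
/-- **`⟨Q⟩ ≥_M ⟨q⟩^{⊗r}` for `q^r ≤ Q`** (`⟨q⟩^{⊗r} ≅ ⟨q^r⟩`, zero-padded into `⟨Q⟩`). [folklore] -/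
theorem tensorMonRestrictsTo_unitTensor_kroneckerPow_unitTensor {q r Q : ℕ} (h : q ^ r ≤ Q) :
    TensorMonRestrictsTo (unitTensor K Q) (kroneckerPow (unitTensor K q) r) := by
  have hinj : Function.Injective (fun a : Fin r → Fin q => Fin.castLE h (finFunctionFinEquiv a)) :=
    (Fin.castLE_injective h).comp finFunctionFinEquiv.injective
  rw [kroneckerPow_unitTensor_eq_comp K h]
  exact tensorMonRestrictsTo_precomp _ hinj hinj hinj

end Powers

/-! ## Induced matchings and the Ruzsa–Szemerédi construction -/

section RuzsaSzemeredi

variable {ι κ μ : Type*} [Fintype ι] [Fintype κ] [Fintype μ]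

variable (K) in
/-- **An induced matching in the support gives a monomial restriction to a diagonal**: if
`φ₁, φ₂, φ₃ : D → …` are injective and `t (φ₁ d₁) (φ₂ d₂) (φ₃ d₃) = [d₁ = d₂ = d₃]`, then
`t ≥_M ⟨|D|⟩` (zero out the complement of the images and relabel; CVZ §2.4: `Q_M` depends only on
the support). [folklore] -/
theorem tensorMonRestrictsTo_unitTensor_of_diagonal {D : Type*} [Fintype D] [DecidableEq D]
    (t : ι → κ → μ → K) (φ₁ : D → ι) (φ₂ : D → κ) (φ₃ : D → μ) (h₁ : Function.Injective φ₁)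
    (h₂ : Function.Injective φ₂) (h₃ : Function.Injective φ₃)
    (hdiag : ∀ d₁ d₂ d₃, t (φ₁ d₁) (φ₂ d₂) (φ₃ d₃) = if d₁ = d₂ ∧ d₂ = d₃ then 1 else 0)
    {R : ℕ} (hR : Fintype.card D = R) :
    TensorMonRestrictsTo t (unitTensor K R) := by
  let e : D ≃ Fin R := Fintype.equivFinOfCardEq hR
  have key : unitTensor K R = fun a b c => t (φ₁ (e.symm a)) (φ₂ (e.symm b)) (φ₃ (e.symm c)) := by
    funext a b c
    rw [hdiag, unitTensor_apply]
    by_cases h : a = b ∧ b = c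
    · rw [if_pos h, if_pos ⟨by rw [h.1], by rw [h.2]⟩]
    · rw [if_neg h, if_neg (fun h' => h ⟨e.symm.injective h'.1, e.symm.injective h'.2⟩)]
  rw [key]
  exact tensorMonRestrictsTo_precomp t (h₁.comp e.symm.injective) (h₂.comp e.symm.injective)
    (h₃.comp e.symm.injective)

variable (K) in
/-- **The Ruzsa–Szemerédi construction.** Let `A ⊆ {0, …, n-1}` contain no non-trivial 3-term
arithmetic progression and `3n ≤ P`. The triangles `(x, x+a, x+2a)` (`x < n`, `a ∈ A`) of the
tripartite "triangle hypergraph" `supp ⟨P,P,P⟩ = {((i,l),(i,j),(j,l))}` are pairwise edge-disjoint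
(an edge determines `(x,a)`) and span no other triangle (`a₁ + a₂ = 2a₃` forces `a₁ = a₂ = a₃`), so
they form an induced matching of size `n·|A|`: `⟨P,P,P⟩ ≥_M ⟨n·|A|⟩`. [folklore] -/
theorem tensorMonRestrictsTo_matMulTensor_unitTensor_of_threeAPFree {n P : ℕ} (hP : 3 * n ≤ P)
    {A : Finset ℕ} (hA : A ⊆ Finset.range n) (h3 : ThreeAPFree (A : Set ℕ)) :
    TensorMonRestrictsTo (matMulTensor K P P P) (unitTensor K (n * A.card)) := by
  have hAlt : ∀ a : A, (a : ℕ) < n := fun a => Finset.mem_range.1 (hA a.2)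
  -- the three edge maps `(x,a) ↦ (i,l) = (x, x+2a)`, `(i,j) = (x, x+a)`, `(j,l) = (x+a, x+2a)`
  let φ₁ : Fin n × A → Fin P × Fin P := fun d =>
    (⟨d.1, by have := d.1.2; omega⟩, ⟨d.1 + 2 * d.2, by have := d.1.2; have := hAlt d.2; omega⟩)
  let φ₂ : Fin n × A → Fin P × Fin P := fun d =>
    (⟨d.1, by have := d.1.2; omega⟩, ⟨d.1 + d.2, by have := d.1.2; have := hAlt d.2; omega⟩)
  let φ₃ : Fin n × A → Fin P × Fin P := fun d =>
    (⟨d.1 + d.2, by have := d.1.2; have := hAlt d.2; omega⟩,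
      ⟨d.1 + 2 * d.2, by have := d.1.2; have := hAlt d.2; omega⟩)
  have hφ₁ : Function.Injective φ₁ := by
    intro d d' h
    simp only [φ₁, Prod.mk.injEq, Fin.mk.injEq] at h
    exact Prod.ext (Fin.ext h.1) (Subtype.ext (by omega))
  have hφ₂ : Function.Injective φ₂ := by
    intro d d' h
    simp only [φ₂, Prod.mk.injEq, Fin.mk.injEq] at h
    exact Prod.ext (Fin.ext h.1) (Subtype.ext (by omega))
  have hφ₃ : Function.Injective φ₃ := by
    intro d d' h
    simp only [φ₃, Prod.mk.injEq, Fin.mk.injEq] at h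
    exact Prod.ext (Fin.ext (by omega)) (Subtype.ext (by omega))
  refine tensorMonRestrictsTo_unitTensor_of_diagonal K (matMulTensor K P P P) φ₁ φ₂ φ₃ hφ₁ hφ₂ hφ₃
    ?_ (by simp)
  intro d₁ d₂ d₃
  by_cases hd : d₁ = d₂ ∧ d₂ = d₃
  · rw [if_pos hd]
    obtain ⟨rfl, rfl⟩ := hd
    simp [matMulTensor, φ₁, φ₂, φ₃]
  · rw [if_neg hd]
    simp only [matMulTensor, φ₁, φ₂, φ₃, Fin.mk.injEq]
    rw [if_neg]
    rintro ⟨e1, e2, e3⟩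
    -- `x₁ = x₂`, `x₂ + a₂ = x₃ + a₃`, `x₁ + 2a₁ = x₃ + 2a₃` force `a₂ + a₃ = a₁ + a₁`
    have hap : (d₂.2 : ℕ) + d₃.2 = d₁.2 + d₁.2 := by omega
    have e21 : (d₂.2 : ℕ) = d₁.2 := h3 d₂.2.2 d₁.2.2 d₃.2.2 hap
    have e31 : (d₃.2 : ℕ) = d₁.2 := by omega
    have e23 : (d₂.1 : ℕ) = d₃.1 := by omega
    exact hd ⟨Prod.ext (Fin.ext e1) (Subtype.ext e21.symm),
      Prod.ext (Fin.ext e23) (Subtype.ext (e21.trans e31.symm))⟩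

end RuzsaSzemeredi

end Literature.Computability.AlgebraicComplexity

end
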